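import Mathlib.Analysis.InnerProductSpace.Basic
import HarnessLib

/-!
# Gram mismatch of a `Q`-orthogonal projection onto an approximate eigenspace

Analysis/OperatorTheory file (everything proved, no named facts). Let `E` be a real inner product
space, `Q : E →ₗ[ℝ] E` symmetric (`⟪Q x, y⟫ = ⟪x, Q y⟫`) and non-negative (`0 ≤ ⟪Q x, x⟫`),
`ψ_j ∈ E` (`j ∈ ι` finite), `f ∈ E`, and `g = Σ_j d_j ψ_j` a *`Q`-orthogonal projection of `f` on
`span ψ`*, i.e. `⟪Q (f − g), ψ_i⟫ = 0` for every `i` (existence is not needed here: `g` is data).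
With the Gram matrix `G_Q := (⟪Q ψ_i, ψ_j⟫)_{ij}` and `λ_j ≠ 0`:

* `⟪Q g, g⟫ ≤ ⟪Q f, f⟫` — Pythagoras in the `Q`-seminorm (`inner_Q_proj_le`);
* `⟪f, Q ψ_j⟫ = Σ_i G_Q i j d_i` — the coefficient identity (`inner_Q_eq_gram_mulVec`);
* `⟪Q g, g⟫ = Σ_i Σ_j d_i d_j G_Q i j` (`inner_Q_proj_eq_form`);
* **Gram mismatch** (`abs_form_sub_weighted_le`): if the finite-dimensional form bound
  `|xᵀ G_Q x − Σ_j λ_j⁻¹ (G_Q x)_j²| ≤ ε · xᵀ G_Q x` holds for every coefficient vector `x`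
  (its least constant is `ε₃ = ‖1 − G_Q^{1/2} Λ⁻¹ G_Q^{1/2}‖`; stated here square-root-free), then
  `|⟪Q g, g⟫ − Σ_j λ_j⁻¹ ⟪f, Q ψ_j⟫²| ≤ ε ⟪Q g, g⟫ ≤ ε ⟪Q f, f⟫`, and with `⟪Q x, x⟫ ≤ M ‖x‖²`
  also `≤ ε M ‖f‖²`;
* the form bound follows from a pair of positive-semidefiniteness checks
  `0 ≤ xᵀ((1+ε) G_Q − G_Q Λ⁻¹ G_Q) x` and `0 ≤ xᵀ(G_Q Λ⁻¹ G_Q − (1−ε) G_Q) x`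
  (`formBound_of_psd_pair`) — the two certificate objects a validated computation produces.

## Why it is here

Elementary linear algebra ([folklore]). Kernel-checks Lemma E.1 of
`pub-nsjs/pub-nsjs-typer/LEMMA-E.md` (Jia–Šverák programme, certified-enclosure lane; the finite-rank
scheme is Hou–Wang–Yang's, arXiv:2509.25116 v2, Lemma "quasi ort" TeX L1745–1752, which is under
adjudication in that cell and is NOT cited for this step — the inequality is re-derived here). Unlike
the companion Lemma E.2 (`QuasiOrthogonalityResidual.lean`), the printed constant of E.1 is valid: the
step `|zᵀ M z| ≤ ‖M‖ |z|²` for symmetric `M` is exactly the form hypothesis above. Nothing about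
Navier–Stokes is typed here.
-/

open Finset

namespace Literature.Analysis.OperatorTheory

variable {E : Type*} [NormedAddCommGroup E] [InnerProductSpace ℝ E]
variable {ι : Type*} [Fintype ι]

/-- `⟪Q(f − g), g⟫ = 0` when `g = Σ d_j ψ_j` and `Q(f − g) ⊥ ψ_i` for all `i`. [folklore] -/
theorem inner_Q_sub_proj_eq_zero (Q : E →ₗ[ℝ] E) (ψ : ι → E) (f : E) (d : ι → ℝ)
    (hproj : ∀ i, inner ℝ (Q (f - ∑ j, d j • ψ j)) (ψ i) = 0) :
    inner ℝ (Q (f - ∑ j, d j • ψ j)) (∑ j, d j • ψ j) = 0 := by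
  rw [inner_sum]
  refine Finset.sum_eq_zero fun i _ => ?_
  rw [real_inner_smul_right, hproj i, mul_zero]

/-- **Pythagoras in the `Q`-seminorm**: `⟪Q g, g⟫ ≤ ⟪Q f, f⟫` for a `Q`-orthogonal projection `g`
of `f`, `Q` symmetric and non-negative. [folklore] -/
theorem inner_Q_proj_le (Q : E →ₗ[ℝ] E) (hsymm : ∀ x y, inner ℝ (Q x) y = inner ℝ x (Q y))
    (hnonneg : ∀ x, 0 ≤ inner ℝ (Q x) x) (ψ : ι → E) (f : E) (d : ι → ℝ)
    (hproj : ∀ i, inner ℝ (Q (f - ∑ j, d j • ψ j)) (ψ i) = 0) :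
    inner ℝ (Q (∑ j, d j • ψ j)) (∑ j, d j • ψ j) ≤ inner ℝ (Q f) f := by
  set g := ∑ j, d j • ψ j with hg
  have h0 : inner ℝ (Q (f - g)) g = 0 := inner_Q_sub_proj_eq_zero Q ψ f d hproj
  have h0' : inner ℝ (Q g) (f - g) = 0 := by
    rw [hsymm, real_inner_comm, h0]
  have hf : f = (f - g) + g := by abel
  have hexp : inner ℝ (Q f) f
      = inner ℝ (Q (f - g)) (f - g) + inner ℝ (Q g) g := by
    conv_lhs => rw [hf]
    rw [map_add, inner_add_left, inner_add_right, inner_add_right, h0, h0']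
    ring
  rw [hexp]
  linarith [hnonneg (f - g)]

/-- **Coefficient identity**: `⟪f, Q ψ_j⟫ = Σ_i ⟪Q ψ_i, ψ_j⟫ d_i` for a `Q`-orthogonal projection
`g = Σ d_i ψ_i` of `f` (`Q` symmetric). [folklore] -/
theorem inner_Q_eq_gram_mulVec (Q : E →ₗ[ℝ] E)
    (hsymm : ∀ x y, inner ℝ (Q x) y = inner ℝ x (Q y)) (ψ : ι → E) (f : E) (d : ι → ℝ)
    (hproj : ∀ i, inner ℝ (Q (f - ∑ j, d j • ψ j)) (ψ i) = 0) (j : ι) :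
    inner ℝ f (Q (ψ j)) = ∑ i, inner ℝ (Q (ψ i)) (ψ j) * d i := by
  have h := hproj j
  rw [map_sub, inner_sub_left, sub_eq_zero] at h
  rw [← hsymm, h, map_sum, sum_inner]
  refine Finset.sum_congr rfl fun i _ => ?_
  rw [map_smul, real_inner_smul_left, mul_comm]

/-- `⟪Q g, g⟫ = Σ_i Σ_j d_i d_j ⟪Q ψ_i, ψ_j⟫` for `g = Σ d_j ψ_j`. [folklore] -/
theorem inner_Q_proj_eq_form (Q : E →ₗ[ℝ] E) (ψ : ι → E) (d : ι → ℝ) :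
    inner ℝ (Q (∑ j, d j • ψ j)) (∑ j, d j • ψ j)
      = ∑ i, ∑ j, d i * d j * inner ℝ (Q (ψ i)) (ψ j) := by
  rw [map_sum, sum_inner]
  refine Finset.sum_congr rfl fun i _ => ?_
  rw [inner_sum]
  refine Finset.sum_congr rfl fun j _ => ?_
  rw [map_smul, real_inner_smul_left, real_inner_smul_right]; ring

/-- **Gram mismatch (Lemma E.1).** Under the finite-dimensional form bound
`|xᵀ G_Q x − Σ_j λ_j⁻¹ (Σ_i G_Q i j x_i)²| ≤ ε xᵀ G_Q x` (least constant
`ε₃ = ‖1 − G_Q^{1/2} Λ⁻¹ G_Q^{1/2}‖`), for a `Q`-orthogonal projection `g = Σ d_j ψ_j` of `f`: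
`|⟪Q g, g⟫ − Σ_j λ_j⁻¹ ⟪f, Q ψ_j⟫²| ≤ ε ⟪Q g, g⟫ ≤ ε ⟪Q f, f⟫`. [folklore] -/
theorem abs_form_sub_weighted_le (Q : E →ₗ[ℝ] E)
    (hsymm : ∀ x y, inner ℝ (Q x) y = inner ℝ x (Q y))
    (hnonneg : ∀ x, 0 ≤ inner ℝ (Q x) x) (ψ : ι → E) (lam : ι → ℝ) {ε : ℝ} (hε0 : 0 ≤ ε)
    (hε : ∀ x : ι → ℝ,
      |(∑ i, ∑ j, x i * x j * inner ℝ (Q (ψ i)) (ψ j))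
        - ∑ j, (lam j)⁻¹ * (∑ i, inner ℝ (Q (ψ i)) (ψ j) * x i) ^ 2|
        ≤ ε * ∑ i, ∑ j, x i * x j * inner ℝ (Q (ψ i)) (ψ j))
    (f : E) (d : ι → ℝ)
    (hproj : ∀ i, inner ℝ (Q (f - ∑ j, d j • ψ j)) (ψ i) = 0) :
    |inner ℝ (Q (∑ j, d j • ψ j)) (∑ j, d j • ψ j)
        - ∑ j, (lam j)⁻¹ * (inner ℝ f (Q (ψ j))) ^ 2|
      ≤ ε * inner ℝ (Q (∑ j, d j • ψ j)) (∑ j, d j • ψ j) ∧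
    ε * inner ℝ (Q (∑ j, d j • ψ j)) (∑ j, d j • ψ j) ≤ ε * inner ℝ (Q f) f := by
  have hc : ∀ j, inner ℝ f (Q (ψ j)) = ∑ i, inner ℝ (Q (ψ i)) (ψ j) * d i :=
    inner_Q_eq_gram_mulVec Q hsymm ψ f d hproj
  refine ⟨?_, ?_⟩
  · rw [inner_Q_proj_eq_form]
    simp_rw [hc]
    exact hε d
  · exact mul_le_mul_of_nonneg_left (inner_Q_proj_le Q hsymm hnonneg ψ f d hproj) hε0

/-- The last step of Lemma E.1: with `⟪Q x, x⟫ ≤ M ‖x‖²`, `ε ⟪Q f, f⟫ ≤ ε M ‖f‖²`. [folklore] -/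
theorem mul_inner_Q_le_of_bound (Q : E →ₗ[ℝ] E) {M ε : ℝ} (hε0 : 0 ≤ ε)
    (hM : ∀ x, inner ℝ (Q x) x ≤ M * ‖x‖ ^ 2) (f : E) :
    ε * inner ℝ (Q f) f ≤ ε * (M * ‖f‖ ^ 2) :=
  mul_le_mul_of_nonneg_left (hM f) hε0

omit [Fintype ι] in
/-- The form bound of `abs_form_sub_weighted_le` follows from two positive-semidefiniteness
checks: `0 ≤ xᵀ((1+ε)G − GΛ⁻¹G)x` and `0 ≤ xᵀ(GΛ⁻¹G − (1−ε)G)x` for all `x`, written with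
`q(x) := xᵀ G x` and `w(x) := Σ_j λ_j⁻¹ (G x)_j²`. [folklore] -/
theorem formBound_of_psd_pair {q w : (ι → ℝ) → ℝ} {ε : ℝ}
    (hup : ∀ x, 0 ≤ (1 + ε) * q x - w x) (hlo : ∀ x, 0 ≤ w x - (1 - ε) * q x) (x : ι → ℝ) :
    |q x - w x| ≤ ε * q x := by
  rw [abs_le]
  constructor <;> linarith [hup x, hlo x]

end Literature.Analysis.OperatorTheory
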